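import Summits.BirchSwinnertonDyer.BirchSwinnertonDyer.Theorems.ManinLocalTwoThreeIstarDeepNormalForm
import Literature.NumberTheory.EllipticCurves.MordellCurveTamagawaIstarProofs
import HarnessLib

/-!
# S-an-63 «16 ∥ N descends», rows `I₄*/12` and `Iₙ*/(n+8)`, `n ≥ 5`: the `χ₋₄`-twist has good (`f₂ = 0`) resp. multiplicative
# (`Iₙ₋₄`, `f₂ = 1`) reduction — Barrios et al. 2025 Thm. 5.1, rows Iₙ* (`n ≥ 4`, `f = 4`), `d ≡ 3 (4)`, for `d = −1`
# (route `ManinLocalTwoThree`, crux C2 `ManinOddAtFour` stmt-BirchSwinnertonDyer-22967; cell bsd-f2-manin, an's candidate S-an-63; p3 gen 12)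

On the deep normal form (sibling `…IstarDeepNormalForm`) of a curve of type `Iₙ*` at `2`, `n ≥ 4`, with `ord₂ Δ_min = n + 8` one has
`a₁ = 2α`, `a₂ = 2p` with `α, p ∈ ℤ₂ˣ` and `(a₃, a₄, a₆) = (2^{i+4}γ, 2^{i+5}q, 2^{2i+8}r)`, `γ ∈ ℤ₂ˣ`, `n = 2i + 5`, or
`(2^{i+4}γ, 2^{i+4}q, 2^{2i+7}r)`, `q ∈ ℤ₂ˣ`, `n = 2i + 4`.  The twist read over `ℚ₂` is `T = [0, −(α²+2p), 0, 2^{i+4}A, −2^{2i+6}B]`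
(`(A, B) = (αγ + 2q, γ² + 4r)` resp. `(q + αγ, γ² + 2r)`), and it is NOT minimal: `(u, r, s, t) = (2, 0, 1, 0)` produces the integral model
`M = [1, −c, 0, 2^i A, −2^{2i} B]`, `c = (α² + 2p + 1)/4`, with `c₄(M)` odd and `Δ(M) = 2^{n−4}·unit` (§2, §3).  So `f₂(W ⊗ (−1)) = 0` for
`n = 4` (good reduction, §1 `conductorExponent_two_eq_zero_of_unitModel`) and `f₂(W ⊗ (−1)) = 1` for `n ≥ 5` (type `Iₙ₋₄`, Ogg).
HONEST FRAMING: a local theorem in print, kernel-checked; nothing about BSD or Manin's conjecture is proved; C2 OPEN.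
[cite: BarriosEtAl2025, Thm. 5.1 (arXiv:2501.03209 p. 16), rows Iₙ* with f = 4] [cite: SilvermanATAEC1994, IV.9.4 and IV.11.1]
-/

set_option autoImplicit false
-- lint-debt: the directory name repeats the summit name (sibling precedent `ManinLocalTwoThreeNegOneTwistConductorAtTwo.lean`)
set_option linter.dupNamespace false

noncomputable section

open scoped Classical
open Polynomial IsLocalRing WeierstrassCurve
open IsDiscreteValuationRing hiding maximalIdeal
open Literature.NumberTheory.DiophantineGeometry Literature.NumberTheory.DiophantineGeometry.TateAlgorithm
  Literature.NumberTheory.DiophantineGeometry.TateAlgorithm.CharTwo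

namespace Summit.BirchSwinnertonDyer.BirchSwinnertonDyer.Theorems.ManinLocalTwoThree

/-! ## §1 Good reduction read on an integral `ℤ₂`-model with unit discriminant -/

/-- **`f₂ = 0` from a `ℤ₂`-model with unit discriminant**: if `W ⊗ ℚ₂ ≅ M ⊗ ℚ₂` with `M` integral and `Δ(M) ∈ ℤ₂ˣ`, then `M` is minimal of
type `I₀` and Ogg's formula (the tree's definition of `f`) gives `f₂(W) = 0 + 1 − 1 = 0`.
[cite: SilvermanAEC2009, VII.1 Remark 1.1 and VII.5.1(a)] [cite: SilvermanATAEC1994, IV.9.4 Step 1 and IV.11.1] -/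
theorem conductorExponent_two_eq_zero_of_unitModel (W : WeierstrassCurve ℚ) [W.IsElliptic] (M : WeierstrassCurve ℤ_[2])
    (Cfin : VariableChange ℚ_[2]) (h : M.map (algebraMap ℤ_[2] ℚ_[2]) = Cfin • W.baseChange ℚ_[2]) (hΔ : IsUnit M.Δ) :
    W.conductorExponent ((Rat.HeightOneSpectrum.primesEquiv (R := ℤ)).symm ⟨2, Nat.prime_two⟩) = 0 := by
  haveI : Fact (Nat.Prime 2) := ⟨Nat.prime_two⟩
  haveI : Finite (ResidueField ℤ_[2]) := Finite.of_equiv _ (PadicInt.residueField (p := 2)).toEquiv.symm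
  set v : IsDedekindDomain.HeightOneSpectrum ℤ := (Rat.HeightOneSpectrum.primesEquiv (R := ℤ)).symm ⟨2, Nat.prime_two⟩ with hvdef
  have e : Rat.HeightOneSpectrum.primesEquiv (R := ℤ) v = ⟨2, Nat.prime_two⟩ := Equiv.apply_symm_apply _ _
  set X : WeierstrassCurve ℚ_[2] := W.baseChange ℚ_[2] with hX
  haveI hmin : (M.baseChange ℚ_[2]).IsMinimal ℤ_[2] :=
    (Literature.NumberTheory.EllipticCurves.Mordell.isMinimal_of_Δ_eq_two_pow_mul M hΔ (by rw [pow_zero, one_mul])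
      (by norm_num)).1
  have hTb : M.baseChange ℚ_[2] = Cfin • X := h
  have hΔ' : (M.baseChange ℚ_[2]).Δ ≠ 0 := by
    rw [hTb]; exact (Cfin • X).isUnit_Δ.ne_zero
  have hkod : X.kodairaSymbol ℤ_[2] = M.kodairaSymbolOfMinimal := by
    rw [kodairaSymbol_eq_kodairaSymbolOfMinimal_of_isMinimal (R := ℤ_[2]) X (M.baseChange ℚ_[2]) Cfin hTb hΔ',
      WeierstrassCurve.integralModel_baseChange_eq]
  have hord : (addVal ℤ_[2] ((X.minimal ℤ_[2]).integralModel ℤ_[2]).Δ).toNat = (addVal ℤ_[2] M.Δ).toNat := by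
    rw [addVal_Δ_minimal_toNat_eq_of_isMinimal (R := ℤ_[2]) X (M.baseChange ℚ_[2]) Cfin hTb hΔ',
      WeierstrassCurve.integralModel_baseChange_eq]
  have hf := WeierstrassCurve.conductorExponent_eq_padic (R := ℤ) v W
  rw [e] at hf
  change W.conductorExponent v =
    (addVal ℤ_[2] ((X.minimal ℤ_[2]).integralModel ℤ_[2]).Δ).toNat + 1 - (X.kodairaSymbol ℤ_[2]).numComponents at hf
  rw [hf, hord, hkod, Literature.NumberTheory.EllipticCurves.TwistGoodTwo.kodairaSymbolOfMinimal_eq_I_zero_of_isUnit_Δ M hΔ, IsDiscreteValuationRing.addVal_eq_zero_iff.mpr hΔ]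
  rfl

/-! ## §2 The twist of the deep `Iₙ*` forms and its rescaled model -/

/-- Twist of the deep form `[2α, 2p, 2^{i+4}γ, 2^{i+5}q, 2^{2i+8}r]` (exit `n = 2i + 5`): `[0, −(α²+2p), 0, 2^{i+4}(αγ+2q), −2^{2i+6}(γ²+4r)]`,
read over `ℚ₂`. [cite: SilvermanAEC2009, X.2 Prop. 2.4 (shape of the quadratic twist)] -/
theorem quadraticTwist_negOne_map_of_deepAForm (N : WeierstrassCurve ℤ_[2]) (i : ℕ) {α p γ q r : ℤ_[2]}
    (h₁ : N.a₁ = 2 * α) (h₂ : N.a₂ = 2 * p) (h₃ : N.a₃ = 2 ^ (i + 4) * γ) (h₄ : N.a₄ = 2 ^ (i + 5) * q)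
    (h₆ : N.a₆ = 2 ^ (2 * i + 8) * r) :
    (N.map (algebraMap ℤ_[2] ℚ_[2])).quadraticTwist (-1) =
      (⟨0, -(α ^ 2 + 2 * p), 0, 2 ^ (i + 4) * (α * γ + 2 * q), -(2 ^ (2 * i + 6) * (γ ^ 2 + 4 * r))⟩ :
        WeierstrassCurve ℤ_[2]).map (algebraMap ℤ_[2] ℚ_[2]) := by
  obtain ⟨a₁, a₂, a₃, a₄, a₆⟩ := N
  simp only at h₁ h₂ h₃ h₄ h₆
  subst h₁ h₂ h₃ h₄ h₆
  have c2 : ((2 : ℤ_[2]) : ℚ_[2]) = 2 := map_ofNat PadicInt.Coe.ringHom 2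
  have c4 : ((4 : ℤ_[2]) : ℚ_[2]) = 4 := map_ofNat PadicInt.Coe.ringHom 4
  ext <;> simp [WeierstrassCurve.quadraticTwist, WeierstrassCurve.map, WeierstrassCurve.b₂, WeierstrassCurve.b₄,
    WeierstrassCurve.b₆, c2, c4] <;> ring

/-- Twist of the deep form `[2α, 2p, 2^{i+4}γ, 2^{i+4}q, 2^{2i+7}r]` (exit `n = 2i + 4`): `[0, −(α²+2p), 0, 2^{i+4}(q+αγ), −2^{2i+6}(γ²+2r)]`,
read over `ℚ₂`. [cite: SilvermanAEC2009, X.2 Prop. 2.4 (shape of the quadratic twist)] -/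
theorem quadraticTwist_negOne_map_of_deepBForm (N : WeierstrassCurve ℤ_[2]) (i : ℕ) {α p γ q r : ℤ_[2]}
    (h₁ : N.a₁ = 2 * α) (h₂ : N.a₂ = 2 * p) (h₃ : N.a₃ = 2 ^ (i + 4) * γ) (h₄ : N.a₄ = 2 ^ (i + 4) * q)
    (h₆ : N.a₆ = 2 ^ (2 * i + 7) * r) :
    (N.map (algebraMap ℤ_[2] ℚ_[2])).quadraticTwist (-1) =
      (⟨0, -(α ^ 2 + 2 * p), 0, 2 ^ (i + 4) * (q + α * γ), -(2 ^ (2 * i + 6) * (γ ^ 2 + 2 * r))⟩ :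
        WeierstrassCurve ℤ_[2]).map (algebraMap ℤ_[2] ℚ_[2]) := by
  obtain ⟨a₁, a₂, a₃, a₄, a₆⟩ := N
  simp only at h₁ h₂ h₃ h₄ h₆
  subst h₁ h₂ h₃ h₄ h₆
  have c2 : ((2 : ℤ_[2]) : ℚ_[2]) = 2 := map_ofNat PadicInt.Coe.ringHom 2
  ext <;> simp [WeierstrassCurve.quadraticTwist, WeierstrassCurve.map, WeierstrassCurve.b₂, WeierstrassCurve.b₄,
    WeierstrassCurve.b₆, c2] <;> ring

/-- **The twist of a deep `Iₙ*` form (`n ≥ 4`, `f = 4`) is not minimal**: `(u, r, s, t) = (2, 0, 1, 0)` takes `[0, −(α²+2p), 0, 2^{i+4}A, −2^{2i+6}B]`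
(`α = 1 + 2κ`, `p = 1 + 2ρ`) to the INTEGRAL model `M = [1, −(1+κ+κ²+ρ), 0, 2^i A, −2^{2i} B]`. [cite: SilvermanAEC2009, III.1 Table 3.1] -/
theorem map_deepScaledModel (i : ℕ) {α p A B κ ρ : ℤ_[2]} (hα : α = 1 + 2 * κ) (hp : p = 1 + 2 * ρ) :
    ((⟨1, -(1 + κ + κ ^ 2 + ρ), 0, 2 ^ i * A, -(2 ^ (2 * i) * B)⟩ : WeierstrassCurve ℤ_[2]).map (algebraMap ℤ_[2] ℚ_[2])) =
      (⟨Units.mk0 (2 : ℚ_[2]) two_ne_zero, 0, 1, 0⟩ : VariableChange ℚ_[2]) •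
        ((⟨0, -(α ^ 2 + 2 * p), 0, 2 ^ (i + 4) * A, -(2 ^ (2 * i + 6) * B)⟩ : WeierstrassCurve ℤ_[2]).map
          (algebraMap ℤ_[2] ℚ_[2])) := by
  subst hα hp
  have c2 : ((2 : ℤ_[2]) : ℚ_[2]) = 2 := map_ofNat PadicInt.Coe.ringHom 2
  ext <;> simp only [variableChange_a₁, variableChange_a₂, variableChange_a₃, variableChange_a₄, variableChange_a₆,
    Units.val_inv_eq_inv_val, Units.val_mk0, map_a₁, map_a₂, map_a₃, map_a₄, map_a₆, PadicInt.algebraMap_apply,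
    PadicInt.coe_mul, PadicInt.coe_add, PadicInt.coe_neg, PadicInt.coe_pow, PadicInt.coe_one, PadicInt.coe_zero, c2] <;>
    field_simp <;> ring

/-- `Δ` and `c₄` of the rescaled model `M = [1, −c, 0, 2^i A, −2^{2i} B]`. [cite: SilvermanAEC2009, III.1 (formulas for b₂, …, Δ)] -/
theorem Δ_c₄_deepScaledModel (c A B : ℤ_[2]) (i : ℕ) :
    (⟨1, -c, 0, 2 ^ i * A, -(2 ^ (2 * i) * B)⟩ : WeierstrassCurve ℤ_[2]).Δ =
        2 ^ (2 * i) * ((1 - 4 * c) ^ 2 * (A ^ 2 + B - 4 * c * B) -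
          2 ^ (i + 3) * (8 * A ^ 3 + 9 * (1 - 4 * c) * A * B + 54 * 2 ^ i * B ^ 2)) ∧
      (⟨1, -c, 0, 2 ^ i * A, -(2 ^ (2 * i) * B)⟩ : WeierstrassCurve ℤ_[2]).c₄ = 1 + 2 * (8 * c ^ 2 - 4 * c - 24 * 2 ^ i * A) := by
  constructor
  · simp only [WeierstrassCurve.Δ, WeierstrassCurve.b₂, WeierstrassCurve.b₄, WeierstrassCurve.b₆, WeierstrassCurve.b₈]
    ring
  · simp only [WeierstrassCurve.c₄, WeierstrassCurve.b₂, WeierstrassCurve.b₄]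
    ring

/-- `Δ(M) = 2^{2i+1}(γ² + 2J)` on the A-branch `(A, B) = (αγ + 2q, γ² + 4r)`, `α = 1 + 2κ`. [cite: SilvermanATAEC1994, IV.9.4 and Table 4.1] -/
theorem Δ_deepScaledModel_A (c γ q r κ : ℤ_[2]) (i : ℕ) : ∃ J : ℤ_[2],
    (⟨1, -c, 0, 2 ^ i * ((1 + 2 * κ) * γ + 2 * q), -(2 ^ (2 * i) * (γ ^ 2 + 4 * r))⟩ : WeierstrassCurve ℤ_[2]).Δ =
      2 ^ (2 * i + 1) * (γ ^ 2 + 2 * J) := by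
  refine ⟨(-128 * κ ^ 3 * γ ^ 3 * (2 ^ i : ℤ_[2]) - 192 * κ ^ 2 * γ ^ 3 * (2 ^ i : ℤ_[2]) - 384 * κ ^ 2 * γ ^ 2 * q * (2 ^ i : ℤ_[2])
         + 16 * κ ^ 2 * γ ^ 2 * c ^ 2 - 8 * κ ^ 2 * γ ^ 2 * c + κ ^ 2 * γ ^ 2 + 144 * κ * γ ^ 3 * c * (2 ^ i : ℤ_[2])
         - 132 * κ * γ ^ 3 * (2 ^ i : ℤ_[2]) - 384 * κ * γ ^ 2 * q * (2 ^ i : ℤ_[2]) + 16 * κ * γ ^ 2 * c ^ 2 - 8 * κ * γ ^ 2 * c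
         + κ * γ ^ 2 - 384 * κ * γ * q ^ 2 * (2 ^ i : ℤ_[2]) + 32 * κ * γ * q * c ^ 2 - 16 * κ * γ * q * c + 2 * κ * γ * q
         + 576 * κ * γ * r * c * (2 ^ i : ℤ_[2]) - 144 * κ * γ * r * (2 ^ i : ℤ_[2]) - 108 * γ ^ 4 * (2 ^ i : ℤ_[2]) ^ 2
         + 72 * γ ^ 3 * c * (2 ^ i : ℤ_[2]) - 34 * γ ^ 3 * (2 ^ i : ℤ_[2]) + 144 * γ ^ 2 * q * c * (2 ^ i : ℤ_[2])
         - 132 * γ ^ 2 * q * (2 ^ i : ℤ_[2]) - 864 * γ ^ 2 * r * (2 ^ i : ℤ_[2]) ^ 2 - 16 * γ ^ 2 * c ^ 3 + 16 * γ ^ 2 * c ^ 2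
         - 5 * γ ^ 2 * c - 192 * γ * q ^ 2 * (2 ^ i : ℤ_[2]) + 16 * γ * q * c ^ 2 - 8 * γ * q * c + γ * q
         + 288 * γ * r * c * (2 ^ i : ℤ_[2]) - 72 * γ * r * (2 ^ i : ℤ_[2]) - 128 * q ^ 3 * (2 ^ i : ℤ_[2]) + 16 * q ^ 2 * c ^ 2
         - 8 * q ^ 2 * c + q ^ 2 + 576 * q * r * c * (2 ^ i : ℤ_[2]) - 144 * q * r * (2 ^ i : ℤ_[2])
         - 1728 * r ^ 2 * (2 ^ i : ℤ_[2]) ^ 2 - 64 * r * c ^ 3 + 48 * r * c ^ 2 - 12 * r * c + r), ?_⟩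
  simp only [WeierstrassCurve.Δ, WeierstrassCurve.b₂, WeierstrassCurve.b₄, WeierstrassCurve.b₆, WeierstrassCurve.b₈]
  ring

/-- `Δ(M) = 2^{2i}(q² + 2J)` on the B-branch `(A, B) = (q + αγ, γ² + 2r)`, `α = 1 + 2κ`. [cite: SilvermanATAEC1994, IV.9.4 and Table 4.1] -/
theorem Δ_deepScaledModel_B (c γ q r κ : ℤ_[2]) (i : ℕ) : ∃ J : ℤ_[2],
    (⟨1, -c, 0, 2 ^ i * (q + (1 + 2 * κ) * γ), -(2 ^ (2 * i) * (γ ^ 2 + 2 * r))⟩ : WeierstrassCurve ℤ_[2]).Δ =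
      2 ^ (2 * i) * (q ^ 2 + 2 * J) := by
  refine ⟨(-256 * κ ^ 3 * γ ^ 3 * (2 ^ i : ℤ_[2]) - 384 * κ ^ 2 * γ ^ 3 * (2 ^ i : ℤ_[2]) - 384 * κ ^ 2 * γ ^ 2 * q * (2 ^ i : ℤ_[2])
         + 32 * κ ^ 2 * γ ^ 2 * c ^ 2 - 16 * κ ^ 2 * γ ^ 2 * c + 2 * κ ^ 2 * γ ^ 2 + 288 * κ * γ ^ 3 * c * (2 ^ i : ℤ_[2])
         - 264 * κ * γ ^ 3 * (2 ^ i : ℤ_[2]) - 384 * κ * γ ^ 2 * q * (2 ^ i : ℤ_[2]) + 32 * κ * γ ^ 2 * c ^ 2 - 16 * κ * γ ^ 2 * c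
         + 2 * κ * γ ^ 2 - 192 * κ * γ * q ^ 2 * (2 ^ i : ℤ_[2]) + 32 * κ * γ * q * c ^ 2 - 16 * κ * γ * q * c + 2 * κ * γ * q
         + 576 * κ * γ * r * c * (2 ^ i : ℤ_[2]) - 144 * κ * γ * r * (2 ^ i : ℤ_[2]) - 216 * γ ^ 4 * (2 ^ i : ℤ_[2]) ^ 2
         + 144 * γ ^ 3 * c * (2 ^ i : ℤ_[2]) - 68 * γ ^ 3 * (2 ^ i : ℤ_[2]) + 144 * γ ^ 2 * q * c * (2 ^ i : ℤ_[2])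
         - 132 * γ ^ 2 * q * (2 ^ i : ℤ_[2]) - 864 * γ ^ 2 * r * (2 ^ i : ℤ_[2]) ^ 2 - 32 * γ ^ 2 * c ^ 3 + 32 * γ ^ 2 * c ^ 2
         - 10 * γ ^ 2 * c + γ ^ 2 - 96 * γ * q ^ 2 * (2 ^ i : ℤ_[2]) + 16 * γ * q * c ^ 2 - 8 * γ * q * c + γ * q
         + 288 * γ * r * c * (2 ^ i : ℤ_[2]) - 72 * γ * r * (2 ^ i : ℤ_[2]) - 32 * q ^ 3 * (2 ^ i : ℤ_[2]) + 8 * q ^ 2 * c ^ 2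
         - 4 * q ^ 2 * c + 288 * q * r * c * (2 ^ i : ℤ_[2]) - 72 * q * r * (2 ^ i : ℤ_[2]) - 864 * r ^ 2 * (2 ^ i : ℤ_[2]) ^ 2
         - 64 * r * c ^ 3 + 48 * r * c ^ 2 - 12 * r * c + r), ?_⟩
  simp only [WeierstrassCurve.Δ, WeierstrassCurve.b₂, WeierstrassCurve.b₄, WeierstrassCurve.b₆, WeierstrassCurve.b₈]
  ring

/-! ## §3 The global assembly: the rescaled model of the twist -/

/-- **The twist of a curve of type `Iₙ*` at `2`, `n ≥ 4`, with `ord₂ Δ_min = n + 8` has an integral `ℤ₂`-model `M` with `c₄(M) ∈ ℤ₂ˣ` and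
`Δ(M) = 2^{n−4}·unit`.** [cite: BarriosEtAl2025, Thm. 5.1 (arXiv:2501.03209 p. 16), rows Iₙ*, f = 4] [cite: SilvermanATAEC1994, IV.9.4] -/
theorem exists_model_negTwist_of_Istar_deep (W : WeierstrassCurve ℚ) [W.IsElliptic] {n : ℕ} (hn : 4 ≤ n)
    (hK : W.kodairaSymbolAt ((Rat.HeightOneSpectrum.primesEquiv (R := ℤ)).symm ⟨2, Nat.prime_two⟩) = .Istar n)
    (hord : W.ordMinimalDiscriminant ((Rat.HeightOneSpectrum.primesEquiv (R := ℤ)).symm ⟨2, Nat.prime_two⟩) = n + 8) :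
    ∃ (M : WeierstrassCurve ℤ_[2]) (Cfin : VariableChange ℚ_[2]) (w : ℤ_[2]), IsUnit w ∧ IsUnit M.c₄ ∧
      M.map (algebraMap ℤ_[2] ℚ_[2]) = Cfin • (W.quadraticTwist ((-1 : ℤ) : ℚ)).baseChange ℚ_[2] ∧ M.Δ = 2 ^ (n - 4) * w := by
  haveI : Fact (Nat.Prime 2) := ⟨Nat.prime_two⟩
  haveI : Finite (ResidueField ℤ_[2]) := Finite.of_equiv _ (PadicInt.residueField (p := 2)).toEquiv.symm
  have hirr : Irreducible (2 : ℤ_[2]) := by exact_mod_cast PadicInt.irreducible_p (p := 2)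
  set v : IsDedekindDomain.HeightOneSpectrum ℤ := (Rat.HeightOneSpectrum.primesEquiv (R := ℤ)).symm ⟨2, Nat.prime_two⟩
    with hvdef
  have e : Rat.HeightOneSpectrum.primesEquiv (R := ℤ) v = ⟨2, Nat.prime_two⟩ := Equiv.apply_symm_apply _ _
  -- Kodaira `Iₙ*` and `ord Δ_min = n + 8`, read over `ℤ₂`
  have hKp := WeierstrassCurve.kodairaSymbolAt_eq_padic (R := ℤ) v W
  rw [e] at hKp
  change W.kodairaSymbolAt v = (((W.baseChange ℚ_[2]).minimal ℤ_[2]).integralModel ℤ_[2]).kodairaSymbolOfMinimal at hKp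
  have hOp := WeierstrassCurve.ordMinimalDiscriminant_eq_padic (R := ℤ) v W
  rw [e] at hOp
  change W.ordMinimalDiscriminant v =
    (IsDiscreteValuationRing.addVal ℤ_[2] (((W.baseChange ℚ_[2]).minimal ℤ_[2]).integralModel ℤ_[2]).Δ).toNat at hOp
  set X : WeierstrassCurve ℚ_[2] := W.baseChange ℚ_[2] with hX
  set V₀ : WeierstrassCurve ℤ_[2] := (X.minimal ℤ_[2]).integralModel ℤ_[2] with hV₀
  set E : VariableChange ℚ_[2] := (X.exists_isMinimal ℤ_[2]).choose with hE
  have hmin : X.minimal ℤ_[2] = E • X := rfl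
  have hV₀X : V₀.baseChange ℚ_[2] = X.minimal ℤ_[2] := WeierstrassCurve.baseChange_integralModel_eq ℤ_[2] _
  rw [hK] at hKp
  rw [hord] at hOp
  have hΔ0 : V₀.Δ ≠ 0 := by
    intro h0; rw [h0] at hOp; simp at hOp
  -- the twist over `ℚ₂`
  set Xm : WeierstrassCurve ℚ_[2] := (W.quadraticTwist ((-1 : ℤ) : ℚ)).baseChange ℚ_[2] with hXm
  have hXmX : Xm = X.quadraticTwist (-1) := by
    rw [hXm, hX, WeierstrassCurve.baseChange, WeierstrassCurve.baseChange, WeierstrassCurve.map_quadraticTwist]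
    simp
  have model : ∀ (D : VariableChange ℤ_[2]) (T M : WeierstrassCurve ℤ_[2]) (S : VariableChange ℚ_[2]),
      ((D • V₀).map (algebraMap ℤ_[2] ℚ_[2])).quadraticTwist (-1) = T.map (algebraMap ℤ_[2] ℚ_[2]) →
      M.map (algebraMap ℤ_[2] ℚ_[2]) = S • T.map (algebraMap ℤ_[2] ℚ_[2]) →
      ∃ Cfin : VariableChange ℚ_[2], M.map (algebraMap ℤ_[2] ℚ_[2]) = Cfin • Xm := by
    intro D T M S hNT hM
    set Ctot : VariableChange ℚ_[2] := D.map (algebraMap ℤ_[2] ℚ_[2]) * E with hCtot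
    have hCX : Ctot • X = (D • V₀).map (algebraMap ℤ_[2] ℚ_[2]) := by
      rw [hCtot, mul_smul, ← hmin, ← hV₀X]
      exact WeierstrassCurve.map_variableChange _ _ _
    set C₁ : VariableChange ℚ_[2] := ⟨Ctot.u, (-1) * Ctot.r, 0, 0⟩ with hC₁
    have hT : T.map (algebraMap ℤ_[2] ℚ_[2]) = C₁ • Xm := by
      rw [← hNT, ← hCX, WeierstrassCurve.quadraticTwist_smul, hXmX]
    exact ⟨S * C₁, by rw [mul_smul, ← hT, hM]⟩
  -- the deep normal form with unit witnesses
  obtain ⟨D, hu, h₁, h₂, h₂n, hbr⟩ := exists_smul_deep_of_kodairaSymbolOfMinimal_eq_Istar hirr V₀ hKp.symm (by omega)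
  have hm : ∀ {x : ℤ_[2]}, x ∈ maximalIdeal ℤ_[2] ↔ (2 : ℤ_[2]) ∣ x := fun {x} ↦ mem_maximalIdeal_iff_dvd_of_irreducible hirr x
  have hmn : ∀ {x : ℤ_[2]} {n : ℕ}, x ∈ maximalIdeal ℤ_[2] ^ n ↔ (2 : ℤ_[2]) ^ n ∣ x := fun {x n} ↦
    mem_maximalIdeal_pow_iff_dvd_of_irreducible hirr x n
  obtain ⟨α, hα⟩ := hm.mp h₁
  obtain ⟨p, hp⟩ := hm.mp h₂
  have hpu : IsUnit p := by
    rw [isUnit_iff_not_dvd hirr]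
    rintro ⟨p', hp'⟩
    exact h₂n (hmn.mpr ⟨p', by rw [hp, hp']; ring⟩)
  obtain ⟨ρ, hρ⟩ := exists_eq_one_add_two_mul_of_isUnit_padicInt hpu
  have hΔN0 : (D • V₀).Δ ≠ 0 := by rw [Δ_smul_of_u_eq_one hu]; exact hΔ0
  have hΔN : (IsDiscreteValuationRing.addVal ℤ_[2] (D • V₀).Δ).toNat = n + 8 := by rw [addVal_Δ_smul_toNat, ← hOp]
  rcases hbr with ⟨k, hnk, h₃, h₃n, h₄, h₆⟩ | ⟨k, hnk, h₃, h₄, h₄n, h₆⟩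
  · -- first-test exit `n = 2k + 1`, `k = i + 2`
    obtain ⟨i, rfl⟩ : ∃ i, k = i + 2 := ⟨k - 2, by omega⟩
    subst hnk
    obtain ⟨γ, hγ⟩ : (2 : ℤ_[2]) ^ (i + 4) ∣ (D • V₀).a₃ := hmn.mp (by simpa [show i + 2 + 2 = i + 4 by omega] using h₃)
    obtain ⟨q, hq⟩ : (2 : ℤ_[2]) ^ (i + 5) ∣ (D • V₀).a₄ := hmn.mp (by simpa [show i + 2 + 3 = i + 5 by omega] using h₄)
    obtain ⟨r, hr⟩ : (2 : ℤ_[2]) ^ (2 * i + 8) ∣ (D • V₀).a₆ :=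
      hmn.mp (by simpa [show 2 * (i + 2) + 4 = 2 * i + 8 by omega] using h₆)
    have hγu : IsUnit γ := by
      rw [isUnit_iff_not_dvd hirr]
      rintro ⟨γ', hγ'⟩
      exact h₃n (hmn.mpr ⟨γ', by rw [show i + 2 + 3 = i + 4 + 1 by omega, hγ, hγ']; ring⟩)
    have hαu : IsUnit α :=
      isUnit_of_istarAForm_of_addVal hirr (D • V₀) (i + 1) hα hp hpu (hγ.trans (by ring)) hγu (hq.trans (by ring))
        (hr.trans (by ring)) (hΔN.trans (by ring))
    obtain ⟨κ, hκ⟩ := exists_eq_one_add_two_mul_of_isUnit_padicInt hαu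
    subst hκ hρ
    have hNT := quadraticTwist_negOne_map_of_deepAForm (D • V₀) i hα hp hγ hq hr
    have hM := map_deepScaledModel i (α := 1 + 2 * κ) (p := 1 + 2 * ρ) (A := (1 + 2 * κ) * γ + 2 * q) (B := γ ^ 2 + 4 * r)
      rfl rfl
    obtain ⟨Cfin, hCfin⟩ := model D _ _ _ hNT hM
    obtain ⟨-, hc₄M⟩ := Δ_c₄_deepScaledModel (1 + κ + κ ^ 2 + ρ) ((1 + 2 * κ) * γ + 2 * q) (γ ^ 2 + 4 * r) i
    obtain ⟨J, hJ⟩ := Δ_deepScaledModel_A (1 + κ + κ ^ 2 + ρ) γ q r κ i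
    refine ⟨_, Cfin, γ ^ 2 + 2 * J, isUnit_add_mul_of_isUnit hirr (hγu.pow 2) _, ?_, hCfin, ?_⟩
    · rw [hc₄M]; exact isUnit_add_mul_of_isUnit hirr isUnit_one _
    · rw [show 2 * (i + 2) + 1 - 4 = 2 * i + 1 by omega]; exact hJ
  · -- second-test exit `n = 2k + 2`, `k = i + 1`
    obtain ⟨i, rfl⟩ : ∃ i, k = i + 1 := ⟨k - 1, by omega⟩
    subst hnk
    obtain ⟨γ, hγ⟩ : (2 : ℤ_[2]) ^ (i + 4) ∣ (D • V₀).a₃ := hmn.mp (by simpa [show i + 1 + 3 = i + 4 by omega] using h₃)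
    obtain ⟨q, hq⟩ : (2 : ℤ_[2]) ^ (i + 4) ∣ (D • V₀).a₄ := hmn.mp (by simpa [show i + 1 + 3 = i + 4 by omega] using h₄)
    obtain ⟨r, hr⟩ : (2 : ℤ_[2]) ^ (2 * i + 7) ∣ (D • V₀).a₆ :=
      hmn.mp (by simpa [show 2 * (i + 1) + 5 = 2 * i + 7 by omega] using h₆)
    have hqu : IsUnit q := by
      rw [isUnit_iff_not_dvd hirr]
      rintro ⟨q', hq'⟩
      exact h₄n (hmn.mpr ⟨q', by rw [show i + 1 + 4 = i + 4 + 1 by omega, hq, hq']; ring⟩)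
    have hαu : IsUnit α :=
      isUnit_of_istarBForm_of_addVal hirr (D • V₀) (i + 1) hα hp (hγ.trans (by ring)) (hq.trans (by ring))
        (hr.trans (by ring)) hΔN0 (hΔN.trans (by ring))
    obtain ⟨κ, hκ⟩ := exists_eq_one_add_two_mul_of_isUnit_padicInt hαu
    subst hκ hρ
    have hNT := quadraticTwist_negOne_map_of_deepBForm (D • V₀) i hα hp hγ hq hr
    have hM := map_deepScaledModel i (α := 1 + 2 * κ) (p := 1 + 2 * ρ) (A := q + (1 + 2 * κ) * γ) (B := γ ^ 2 + 2 * r)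
      rfl rfl
    obtain ⟨Cfin, hCfin⟩ := model D _ _ _ hNT hM
    obtain ⟨-, hc₄M⟩ := Δ_c₄_deepScaledModel (1 + κ + κ ^ 2 + ρ) (q + (1 + 2 * κ) * γ) (γ ^ 2 + 2 * r) i
    obtain ⟨J, hJ⟩ := Δ_deepScaledModel_B (1 + κ + κ ^ 2 + ρ) γ q r κ i
    refine ⟨_, Cfin, q ^ 2 + 2 * J, isUnit_add_mul_of_isUnit hirr (hqu.pow 2) _, ?_, hCfin, ?_⟩
    · rw [hc₄M]; exact isUnit_add_mul_of_isUnit hirr isUnit_one _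
    · rw [show 2 * (i + 1) + 2 - 4 = 2 * i by omega]; exact hJ

/-- **S-an-63, row `I₄*/12`** (Barrios et al. 2025 Thm. 5.1, row I₄*, `d ≡ 3 (4)`, kernel-checked for `d = −1`): if `W/ℚ` is of Kodaira type
`I₄*` at `2` with `ord₂ Δ_min = 12` (the `f₂ = 4` stratum of type `I₄*`), then `W ⊗ (−1)` has good reduction at `2`: `f₂(W ⊗ (−1)) = 0`.
[cite: BarriosEtAl2025, Thm. 5.1 (arXiv:2501.03209 p. 16), row I₄*, (f, f^d) = (4,0)] [cite: SilvermanATAEC1994, IV.9.4 and IV.11.1] -/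
theorem conductorExponent_quadraticTwist_negOne_of_IstarFour_twelve (W : WeierstrassCurve ℚ) [W.IsElliptic]
    (hK : W.kodairaSymbolAt ((Rat.HeightOneSpectrum.primesEquiv (R := ℤ)).symm ⟨2, Nat.prime_two⟩) = .Istar 4)
    (hord : W.ordMinimalDiscriminant ((Rat.HeightOneSpectrum.primesEquiv (R := ℤ)).symm ⟨2, Nat.prime_two⟩) = 12) :
    (W.quadraticTwist ((-1 : ℤ) : ℚ)).conductorExponent ((Rat.HeightOneSpectrum.primesEquiv (R := ℤ)).symm ⟨2, Nat.prime_two⟩) = 0 := by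
  have hd0 : ((-1 : ℤ) : ℚ) ≠ 0 := by norm_num
  haveI := W.isElliptic_quadraticTwist hd0
  obtain ⟨M, Cfin, w, hw, -, hM, hΔ⟩ := exists_model_negTwist_of_Istar_deep W le_rfl hK hord
  refine conductorExponent_two_eq_zero_of_unitModel _ M Cfin hM ?_
  rw [hΔ]; simpa using hw

/-- **S-an-63, rows `Iₙ*/(n+8)`, `n ≥ 5`** (Barrios et al. 2025 Thm. 5.1, rows Iₙ*, `d ≡ 3 (4)`, kernel-checked for `d = −1`): if `W/ℚ` is of
Kodaira type `Iₙ*` at `2`, `n ≥ 5`, with `ord₂ Δ_min = n + 8` (the `f₂ = 4` stratum), then `W ⊗ (−1)` is multiplicative of type `Iₙ₋₄`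
at `2`: `f₂(W ⊗ (−1)) = 1`. [cite: BarriosEtAl2025, Thm. 5.1 (arXiv:2501.03209 p. 16), rows Iₙ*, (f, f^d) = (4,1)]
[cite: SilvermanATAEC1994, IV.9.4 Step 2 and IV.11.1] -/
theorem conductorExponent_quadraticTwist_negOne_of_Istar_of_five_le (W : WeierstrassCurve ℚ) [W.IsElliptic] {n : ℕ} (hn : 5 ≤ n)
    (hK : W.kodairaSymbolAt ((Rat.HeightOneSpectrum.primesEquiv (R := ℤ)).symm ⟨2, Nat.prime_two⟩) = .Istar n)
    (hord : W.ordMinimalDiscriminant ((Rat.HeightOneSpectrum.primesEquiv (R := ℤ)).symm ⟨2, Nat.prime_two⟩) = n + 8) :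
    (W.quadraticTwist ((-1 : ℤ) : ℚ)).conductorExponent ((Rat.HeightOneSpectrum.primesEquiv (R := ℤ)).symm ⟨2, Nat.prime_two⟩) = 1 := by
  haveI : Fact (Nat.Prime 2) := ⟨Nat.prime_two⟩
  have hirr : Irreducible (2 : ℤ_[2]) := by exact_mod_cast PadicInt.irreducible_p (p := 2)
  obtain ⟨M, Cfin, w, hw, hc₄, hM, hΔ⟩ := exists_model_negTwist_of_Istar_deep W (by omega) hK hord
  have hd : n - 4 ≠ 0 := by omega
  have hval : (IsDiscreteValuationRing.addVal ℤ_[2] M.Δ).toNat = n - 4 :=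
    addVal_toNat_eq_of_two hirr hw (J := 0) (by rw [hΔ]; ring)
  have hkod : M.kodairaSymbolOfMinimal = .I (n - 4) := by
    rw [kodairaSymbolOfMinimal_eq_I_iff M hd]
    refine ⟨(mem_maximalIdeal_iff_dvd_of_irreducible hirr _).mpr ?_,
      fun h ↦ (isUnit_iff_not_dvd hirr _).mp hc₄ ((mem_maximalIdeal_iff_dvd_of_irreducible hirr _).mp h), hval⟩
    obtain ⟨d, hd'⟩ := Nat.exists_eq_succ_of_ne_zero hd
    rw [hΔ, hd', pow_succ]
    exact Dvd.dvd.mul_right (dvd_mul_left _ _) _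
  have hne : M.kodairaSymbolOfMinimal ≠ .I 0 := by
    rw [hkod]; intro h; injection h with h; exact hd h
  rw [conductorExponent_negTwist_of_exitModel W M Cfin hM hne, hkod, hval, KodairaSymbol.numComponents_I_of_ne_zero hd]
  omega

end Summit.BirchSwinnertonDyer.BirchSwinnertonDyer.Theorems.ManinLocalTwoThree

end
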